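import Summits.QuantumFields.YangMills.Theorems.BalabanUVNodesN20KeyedRelWeightOverCut

/-!
# BalabanUVNodes ∕ N20 (NE7b) — THE N20 FACE AT THE SPINE READING OF RECORD IN CANONICAL FORM: `RelWeightBound` there ⟺ `∀ K, W K < 1` ∧ `Summable W` for ONE DEFINITE
# sequence `W = wInf …` — the LEAST relative weight of the persistence class of record —, which is ALWAYS admissible and `≤ 1` (the keyed weights of record are `≥ 0` and the
# class consists of classes), equals `0` at the zero cut (dag-n20-w1) and equals `1` at every over-cut step on a live tuple (module `…N20KeyedRelWeightOverCut`)

Cell `pub-ymgap` (HUMAN RULING D-0062 Track A; work-bound push D-0149, director-ym №197), width seat `pub-ymgap-dag-n20-w2` (gen 2) on node N20 = NE7b; CLAIM-2 of the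
re-seat, continuation of CLAIM-1 `Thm/BalabanUVNodesN20KeyedRelWeightOverCut` (the over-cut end).  Filed `--kind proof --supports stmt-QuantumFields-20544 --as helper` (K3⁷
`SpineGivenEndpointR13SepCoPH`); COUNT-NEUTRAL; LOCATED.  [III] = [Balaban1988Convergent], [LF-II] = [Balaban1989LargeFieldII].

WHY.  dag-n20-d's `Thm/BalabanUVNodesSpineCanonicalWeights` pins the reading's weight `W := wInf …` (the infimum of the ADMISSIBLE relative weights of the bad class) and proves
«any witness transfers» (`relWeightBound_wInf_iff`: `RelWeightBound … (wInf …) ↔ ∃ W, RelWeightBound … W`); its header says «NE7b's content at a reading is exactly `∀ K, wInf K < 1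
∧ Summable wInf`» — true WHEN some weight is admissible at every step.  At the reading of record that proviso is FREE: the keyed class weights `weightA₁₃ ∕ weightB₁₃` are `≥ 0`
at a tuple with core provisos (gen 0's `weightA₁₃_nonneg`, from the provisos' ζ-rows) and `badClass₁₃ ⊆ classSet₁₃` (dag-n20-d), so the weight `1` is admissible at EVERY step,
the canonical weight is attained and `≤ 1`, and the N20 face of K3⁷ v3 stub 2 at the pinned reading becomes TWO NUMERIC CONDITIONS ON ONE DEFINITE SEQUENCE — the
«persistent-activity fraction of record» `K ↦ (crOfRecord₁₃VAt K₀ jcut sh F θ hP g₀ os).W K ∈ [0, 1]`: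
* §1 (generic `ι`, folklore; hypotheses `0 ≤ A, B` on `T` and `Bad ⊆ T` on `|t| ≤ l₀`) `one_mem_admW` · `admW_nonempty` · `wInf_mem` · `wInf_le_one` · `bad_left_wInf` ∕ `bad_right_wInf`
  (the canonical weight IS a relative weight of the class) · `admW_subset_admW_of_subset` · `wInf_mono_of_subset` (the canonical weight is MONOTONE in the class: the dial's interior
  read on the fraction) · ★ `relWeightBound_wInf_iff_lt_one_summable` · ★ `exists_relWeightBound_iff_lt_one_summable` · `wInf_eq_one_of_bad_eq`
  (`Bad K t₀ = T K` at one admissible `t₀` with positive run-A total ⇒ `wInf K = 1`) · `wInf_eq_zero_of_bad_sums_eq_zero`;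
* §2 (the reading of record, EVERY Stage-13 tuple with core provisos, every `K₀ jcut sh g₀ os`) `one_mem_admW_carriers₁₃` · `W_crOfRecord₁₃VAt_le_one` · `W_crOfRecord₁₃VAt_mem_Icc` ·
  `badMass_le_W_crOfRecord₁₃VAt_left ∕ _right` (the reading's `W` IS admissible: both runs' persistence-class masses `≤ W K ·` totals, hypothesis-free) · ★★ `relWeightBound_crOfRecord₁₃VAt_iff`
  (`RelWeightBound` at the reading ⟺ `(∀ K, W K < 1) ∧ Summable W`) · `relWeightBound_crOfRecord₁₃At_iff` (v1.0 twin) · ★★ `keyedRelWeight_shape_crOfRecord₁₃VAt_iff` (the K3⁷ v3 `KeyedRelWeight`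
  BODY at the per-tuple-cut V reading, `N = 2` ⟺ the keyed family of those two numeric conditions);
* §3 (the two ends, on the live line) ★ `W_crOfRecord₁₃VAt_eq_one_of_overCut` (`K₀ + K < jcut K ⇒ W K = 1`: CLAIM-1's `badClass₁₃ = classSet₁₃` + E1 + `schemeZ_pos_datumOfRecord₁₃CoPH`) ·
  `W_crOfRecord₁₃At_eq_one_of_overCut`; the zero end `W K = 0` at `jcut = 0` is dag-n20-w1's `crOfRecord₁₃VAt_W_cutZero` (p595788) — CITED, not re-typed.
WHAT IT SAYS FOR THE STUB (located, count-neutral): on a live tuple the N20 conjunct of `stub_expansion13H` at the pinned reading is «the persistent-activity fractions of record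
`W K ∈ [0, 1]` under the cut reading `jc` are `< 1` at every step and summable» — `W ≡ 0` at the bottom of the dial, `W K = 1` above the window, the located NE7b content of record
(NOT PRINTED for d = 4, NOT proved) = the DECAY of that one sequence inside the window.
Cited BY NAME, not re-typed: dag-n20-d `…SpineCanonicalWeights` (`admW`, `wInf`, `wInf_nonneg`, `wInf_le_of_mem`, `wInf_mem_of_nonempty`, `relWeightBound_wInf_iff`), `…SpineReadingOfRecord13CoPH(V)`
(`classSet₁₃`, `weightA∕B₁₃`, `badClass₁₃`, `badClass₁₃_subset`, `crOfRecord₁₃(V)At`, `schemeZ_eq_sum_classSet_weightA`), gen 0 `…N21KeyedShellWeightShellZero` (`weightA₁₃_nonneg`,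
`weightB₁₃_nonneg`, `zeta_nonneg_of_provisos₁₃CoPH`), this seat's CLAIM-1 `…N20KeyedRelWeightOverCut` (`badClass₁₃_eq_classSet₁₃_of_overCut`), `…N20AtRecord13CoPH.schemeZ_pos_datumOfRecord₁₃CoPH`,
`T4WeightBudget.RelWeightBound` :117.

HONEST FRAMING.  Real-analysis ∕ finite-sum bookkeeping; NO weight bounded, NO estimate proved; a located reading of the registered stub text, count-neutral.  Nothing of Bałaban's
is asserted; NE7 ∕ NE7b ∕ NE7c NOT PRINTED for `d = 4`, NOT proved; (α)-instance 0∕1; no `Provisos₁₃CoPH` inhabitant claimed (K0⁷ OPEN); N19 ∕ N20 ∕ N21 ∕ N27 NOT discharged; K3⁷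
NOT closed; counts unmoved (typed 28∕28 · discharged 5∕27); no count claim (the chair's single count line is the only count).  One finite `𝕋⁴_{L^K}` programme at fixed
`ε = L^{−K}`, Bałaban AS PRINTED; the YM mass gap (Clay) is NOT proved by any of this — R4 closes the conditional finite-𝕋⁴ rung `BalabanLadder.UV` only; NOT ℝ⁴, NOT infinite
volume, NOT OS.  No `def`, no `instance`, no `notation`, no `sorry`.  Sources (locators, bookkeeping only): [III] (2.18) p.257; [LF-II] Thm 1 + (0.1) pp.355–356, (1.80) p.384;
[King1986] (3.10)–(3.11) p.656.
-/

noncomputable section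

open scoped BigOperators

namespace Summit.QuantumFields.YangMills.BalabanUVNodes.N20KeyedRelWeightCanonical

open Literature.MathematicalPhysics.QuantumFieldTheory.Balaban1983to89 Literature.MathematicalPhysics.QuantumFieldTheory.Balaban1983to89.Node00
open T4Continuum
open T4WeightBudget (RelWeightBound)
open YMDAG.UVSplit hiding SU
open Summit.QuantumFields.YangMills.BalabanUVNodes.SpineCanonicalWeights
open Summit.QuantumFields.YangMills.Theorems.N20AtRecord13 (schemeZ_pos_datumOfRecord₁₃CoPH)
open Summit.QuantumFields.YangMills.BalabanUVNodes.N21KeyedShellWeightShellZero (zeta_nonneg_of_provisos₁₃CoPH weightA₁₃_nonneg weightB₁₃_nonneg)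
open Summit.QuantumFields.YangMills.BalabanUVNodes.N20KeyedRelWeightOverCut (badClass₁₃_eq_classSet₁₃_of_overCut)

/-! ## §1  Folklore: with non-negative terms and `Bad ⊆ T` the weight `1` is admissible, the canonical weight is attained and `≤ 1`, and `RelWeightBound` at it is two numeric conditions -/

section Generic

variable {ι : Type*} {l₀ : ℝ} {T : ℕ → Finset ι} {A B : ℕ → ℝ → ι → ℝ} {Bad : ℕ → ℝ → Finset ι}

/-- **THE WEIGHT `1` IS ADMISSIBLE** for a class of non-negative terms contained in `T`: `Σ_Bad ≤ 1 · Σ_T` in both runs. [cite: King1986, (3.10)–(3.11) p.656 (bookkeeping)] -/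
theorem one_mem_admW (hA : ∀ (K : ℕ) (t : ℝ), |t| ≤ l₀ → ∀ τ ∈ T K, 0 ≤ A K t τ) (hB : ∀ (K : ℕ) (t : ℝ), |t| ≤ l₀ → ∀ τ ∈ T K, 0 ≤ B K t τ)
    (hsub : ∀ (K : ℕ) (t : ℝ), |t| ≤ l₀ → Bad K t ⊆ T K) (K : ℕ) : (1 : ℝ) ∈ admW l₀ T A B Bad K := by
  refine ⟨zero_le_one, fun t ht => ⟨?_, ?_⟩⟩
  · rw [one_mul]
    exact Finset.sum_le_sum_of_subset_of_nonneg (hsub K t ht) fun τ hτ _ => hA K t ht τ hτ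
  · rw [one_mul]
    exact Finset.sum_le_sum_of_subset_of_nonneg (hsub K t ht) fun τ hτ _ => hB K t ht τ hτ

/-- … so the admissible weights are non-empty at every step. [cite: King1986, (3.10)–(3.11) p.656 (bookkeeping)] -/
theorem admW_nonempty (hA : ∀ (K : ℕ) (t : ℝ), |t| ≤ l₀ → ∀ τ ∈ T K, 0 ≤ A K t τ) (hB : ∀ (K : ℕ) (t : ℝ), |t| ≤ l₀ → ∀ τ ∈ T K, 0 ≤ B K t τ)
    (hsub : ∀ (K : ℕ) (t : ℝ), |t| ≤ l₀ → Bad K t ⊆ T K) (K : ℕ) : (admW l₀ T A B Bad K).Nonempty :=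
  ⟨1, one_mem_admW hA hB hsub K⟩

/-- … and **THE CANONICAL WEIGHT IS ADMISSIBLE** (attained infimum, dag-n20-d's `wInf_mem_of_nonempty`). [cite: King1986, (3.10)–(3.11) p.656 (bookkeeping)] -/
theorem wInf_mem (hA : ∀ (K : ℕ) (t : ℝ), |t| ≤ l₀ → ∀ τ ∈ T K, 0 ≤ A K t τ) (hB : ∀ (K : ℕ) (t : ℝ), |t| ≤ l₀ → ∀ τ ∈ T K, 0 ≤ B K t τ)
    (hsub : ∀ (K : ℕ) (t : ℝ), |t| ≤ l₀ → Bad K t ⊆ T K) (K : ℕ) : wInf l₀ T A B Bad K ∈ admW l₀ T A B Bad K :=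
  wInf_mem_of_nonempty (admW_nonempty hA hB hsub K)

/-- **THE CANONICAL WEIGHT IS `≤ 1`.** [cite: King1986, (3.10)–(3.11) p.656 (bookkeeping)] -/
theorem wInf_le_one (hA : ∀ (K : ℕ) (t : ℝ), |t| ≤ l₀ → ∀ τ ∈ T K, 0 ≤ A K t τ) (hB : ∀ (K : ℕ) (t : ℝ), |t| ≤ l₀ → ∀ τ ∈ T K, 0 ≤ B K t τ)
    (hsub : ∀ (K : ℕ) (t : ℝ), |t| ≤ l₀ → Bad K t ⊆ T K) (K : ℕ) : wInf l₀ T A B Bad K ≤ 1 :=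
  wInf_le_of_mem (one_mem_admW hA hB hsub K)

/-- **THE CANONICAL WEIGHT IS A RELATIVE WEIGHT OF THE CLASS, run A**: `Σ_{Bad K t} A ≤ wInf K · Σ_{T K} A` for every `|t| ≤ l₀`. [cite: King1986, (3.10)–(3.11) p.656 (bookkeeping)] -/
theorem bad_left_wInf (hA : ∀ (K : ℕ) (t : ℝ), |t| ≤ l₀ → ∀ τ ∈ T K, 0 ≤ A K t τ) (hB : ∀ (K : ℕ) (t : ℝ), |t| ≤ l₀ → ∀ τ ∈ T K, 0 ≤ B K t τ)
    (hsub : ∀ (K : ℕ) (t : ℝ), |t| ≤ l₀ → Bad K t ⊆ T K) (K : ℕ) {t : ℝ} (ht : |t| ≤ l₀) :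
    ∑ τ ∈ Bad K t, A K t τ ≤ wInf l₀ T A B Bad K * ∑ τ ∈ T K, A K t τ :=
  ((wInf_mem hA hB hsub K).2 t ht).1

/-- **… run B.** [cite: King1986, (3.10)–(3.11) p.656 (bookkeeping)] -/
theorem bad_right_wInf (hA : ∀ (K : ℕ) (t : ℝ), |t| ≤ l₀ → ∀ τ ∈ T K, 0 ≤ A K t τ) (hB : ∀ (K : ℕ) (t : ℝ), |t| ≤ l₀ → ∀ τ ∈ T K, 0 ≤ B K t τ)
    (hsub : ∀ (K : ℕ) (t : ℝ), |t| ≤ l₀ → Bad K t ⊆ T K) (K : ℕ) {t : ℝ} (ht : |t| ≤ l₀) :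
    ∑ τ ∈ Bad K t, B K t τ ≤ wInf l₀ T A B Bad K * ∑ τ ∈ T K, B K t τ :=
  ((wInf_mem hA hB hsub K).2 t ht).2

/-- **A LARGER CLASS HAS FEWER ADMISSIBLE WEIGHTS** (non-negative terms): if `Bad ⊆ Bad' ⊆ T` on `|t| ≤ l₀` then every weight admissible for `Bad'` is admissible for `Bad`.
[cite: King1986, (3.10)–(3.11) p.656 (bookkeeping)] -/
theorem admW_subset_admW_of_subset (hA : ∀ (K : ℕ) (t : ℝ), |t| ≤ l₀ → ∀ τ ∈ T K, 0 ≤ A K t τ) (hB : ∀ (K : ℕ) (t : ℝ), |t| ≤ l₀ → ∀ τ ∈ T K, 0 ≤ B K t τ)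
    {Bad' : ℕ → ℝ → Finset ι} (hBB : ∀ (K : ℕ) (t : ℝ), |t| ≤ l₀ → Bad K t ⊆ Bad' K t) (hsub' : ∀ (K : ℕ) (t : ℝ), |t| ≤ l₀ → Bad' K t ⊆ T K) (K : ℕ) :
    admW l₀ T A B Bad' K ⊆ admW l₀ T A B Bad K := fun _ hw =>
  ⟨hw.1, fun t ht =>
    ⟨(Finset.sum_le_sum_of_subset_of_nonneg (hBB K t ht) fun τ hτ _ => hA K t ht τ (hsub' K t ht hτ)).trans (hw.2 t ht).1,
      (Finset.sum_le_sum_of_subset_of_nonneg (hBB K t ht) fun τ hτ _ => hB K t ht τ (hsub' K t ht hτ)).trans (hw.2 t ht).2⟩⟩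

/-- **THE CANONICAL WEIGHT IS MONOTONE IN THE CLASS**: `Bad ⊆ Bad' ⊆ T` (non-negative terms) ⇒ `wInf … Bad K ≤ wInf … Bad' K` — the canonical-weight form of
`T4BadClassBooking.relWeightBound_mono`; at the reading of record it is the monotone interior of the cut dial read on the persistent-activity fraction (a deeper cut, a larger fraction).
[cite: King1986, (3.10)–(3.11) p.656; Balaban1989LargeFieldII, (1.80) p.384 (bookkeeping)] -/
theorem wInf_mono_of_subset (hA : ∀ (K : ℕ) (t : ℝ), |t| ≤ l₀ → ∀ τ ∈ T K, 0 ≤ A K t τ) (hB : ∀ (K : ℕ) (t : ℝ), |t| ≤ l₀ → ∀ τ ∈ T K, 0 ≤ B K t τ)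
    {Bad' : ℕ → ℝ → Finset ι} (hBB : ∀ (K : ℕ) (t : ℝ), |t| ≤ l₀ → Bad K t ⊆ Bad' K t) (hsub' : ∀ (K : ℕ) (t : ℝ), |t| ≤ l₀ → Bad' K t ⊆ T K) (K : ℕ) :
    wInf l₀ T A B Bad K ≤ wInf l₀ T A B Bad' K :=
  wInf_le_of_mem (admW_subset_admW_of_subset hA hB hBB hsub' K (wInf_mem hA hB hsub' K))

/-- **★ `RelWeightBound` AT THE CANONICAL WEIGHT ⟺ TWO NUMERIC CONDITIONS ON IT**: `wInf K < 1` at every step and `Summable wInf` (non-negative terms, `Bad ⊆ T`; the other four clauses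
of `RelWeightBound` hold at `wInf` unconditionally). [cite: King1986, (3.10)–(3.11) p.656; Balaban1989LargeFieldII, Thm 1 + (0.1) pp.355–356 (bookkeeping)] -/
theorem relWeightBound_wInf_iff_lt_one_summable (hA : ∀ (K : ℕ) (t : ℝ), |t| ≤ l₀ → ∀ τ ∈ T K, 0 ≤ A K t τ)
    (hB : ∀ (K : ℕ) (t : ℝ), |t| ≤ l₀ → ∀ τ ∈ T K, 0 ≤ B K t τ) (hsub : ∀ (K : ℕ) (t : ℝ), |t| ≤ l₀ → Bad K t ⊆ T K) :
    RelWeightBound l₀ T A B Bad (wInf l₀ T A B Bad) ↔ (∀ K, wInf l₀ T A B Bad K < 1) ∧ Summable (wInf l₀ T A B Bad) := by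
  refine ⟨fun h => ⟨h.lt_one, h.summable⟩, fun ⟨h1, hs⟩ => ?_⟩
  exact
    { bad_subset := hsub
      nonneg := wInf_nonneg
      lt_one := h1
      summable := hs
      bad_left := fun K t ht => bad_left_wInf hA hB hsub K ht
      bad_right := fun K t ht => bad_right_wInf hA hB hsub K ht }

/-- **★ SOME `RelWeightBound` EXISTS ⟺ THE SAME TWO NUMERIC CONDITIONS ON THE CANONICAL WEIGHT** (dag-n20-d's `relWeightBound_wInf_iff` + the above).
[cite: King1986, (3.10)–(3.11) p.656; Balaban1989LargeFieldII, Thm 1 + (0.1) pp.355–356 (bookkeeping)] -/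
theorem exists_relWeightBound_iff_lt_one_summable (hA : ∀ (K : ℕ) (t : ℝ), |t| ≤ l₀ → ∀ τ ∈ T K, 0 ≤ A K t τ)
    (hB : ∀ (K : ℕ) (t : ℝ), |t| ≤ l₀ → ∀ τ ∈ T K, 0 ≤ B K t τ) (hsub : ∀ (K : ℕ) (t : ℝ), |t| ≤ l₀ → Bad K t ⊆ T K) :
    (∃ W : ℕ → ℝ, RelWeightBound l₀ T A B Bad W) ↔ (∀ K, wInf l₀ T A B Bad K < 1) ∧ Summable (wInf l₀ T A B Bad) := by
  rw [← relWeightBound_wInf_iff, relWeightBound_wInf_iff_lt_one_summable hA hB hsub]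

/-- **THE CANONICAL WEIGHT AT A STEP WHERE THE CLASS IS EVERYTHING IS `1`**: if `Bad K t₀ = T K` at one admissible `t₀` with positive run-A total (non-negative terms, `Bad ⊆ T`).
[cite: King1986, (3.10)–(3.11) p.656; Balaban1989LargeFieldII, (1.80) p.384 (bookkeeping)] -/
theorem wInf_eq_one_of_bad_eq (hA : ∀ (K : ℕ) (t : ℝ), |t| ≤ l₀ → ∀ τ ∈ T K, 0 ≤ A K t τ) (hB : ∀ (K : ℕ) (t : ℝ), |t| ≤ l₀ → ∀ τ ∈ T K, 0 ≤ B K t τ)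
    (hsub : ∀ (K : ℕ) (t : ℝ), |t| ≤ l₀ → Bad K t ⊆ T K) {K : ℕ} {t₀ : ℝ} (ht₀ : |t₀| ≤ l₀) (h : Bad K t₀ = T K) (hpos : 0 < ∑ τ ∈ T K, A K t₀ τ) :
    wInf l₀ T A B Bad K = 1 := by
  refine le_antisymm (wInf_le_one hA hB hsub K) ?_
  have h₁ := bad_left_wInf hA hB hsub K ht₀
  rw [h] at h₁
  exact le_of_mul_le_mul_right (by rw [one_mul]; exact h₁) hpos

/-- **THE CANONICAL WEIGHT AT A STEP WHERE THE CLASS WEIGHS NOTHING IS `0`**: if both runs' bad sums vanish at every admissible source. [cite: King1986, (3.10)–(3.11) p.656 (bookkeeping)] -/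
theorem wInf_eq_zero_of_bad_sums_eq_zero {K : ℕ} (hA0 : ∀ t : ℝ, |t| ≤ l₀ → ∑ τ ∈ Bad K t, A K t τ = 0) (hB0 : ∀ t : ℝ, |t| ≤ l₀ → ∑ τ ∈ Bad K t, B K t τ = 0) :
    wInf l₀ T A B Bad K = 0 :=
  le_antisymm (wInf_le_of_mem ⟨le_rfl, fun t ht => ⟨by rw [hA0 t ht, zero_mul], by rw [hB0 t ht, zero_mul]⟩⟩) (wInf_nonneg K)

end Generic

/-! ## §2  At the spine reading of record: the N20 face is two numeric conditions on the persistent-activity fraction of record `W K ∈ [0, 1]` -/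

section Reading

variable {F : T4Family} {N : ℕ} [NeZero N] (θ : Stage13HParams F N) (hP : θ.Provisos₁₃CoPH F N) (K₀ : ℕ) (g₀ : ℕ → ℝ) (os : List (ULoop F)) (jcut : ℕ → ℕ)

/-- **AT THE CARRIERS OF RECORD THE WEIGHT `1` IS ADMISSIBLE AT EVERY STEP** (keyed weights `≥ 0` at a tuple with core provisos; the persistence class consists of classes).
[cite: Balaban1988Convergent, (2.18) p.257; King1986, (3.10)–(3.11) p.656 (bookkeeping)] -/
theorem one_mem_admW_carriers₁₃ (K : ℕ) :
    (1 : ℝ) ∈ admW 1 (classSet₁₃ θ K₀ g₀) (weightA₁₃ θ hP K₀ g₀ os) (weightB₁₃ θ hP K₀ g₀ os) (badClass₁₃ θ K₀ g₀ jcut) K :=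
  one_mem_admW (fun K t _ x _ => weightA₁₃_nonneg F θ hP K₀ g₀ os K t x) (fun K t _ x _ => weightB₁₃_nonneg F θ hP K₀ g₀ os K t x)
    (fun K t _ => badClass₁₃_subset θ K₀ g₀ jcut K t) K

variable (sh : ShellSplit₁₃CoPH N K₀)

/-- **THE PERSISTENT-ACTIVITY FRACTION OF RECORD IS `≤ 1`**: `(crOfRecord₁₃VAt K₀ jcut sh F θ hP g₀ os).W K ≤ 1` at every step, every tuple with core provisos.
[cite: Balaban1989LargeFieldII, (1.80) p.384; King1986, (3.10)–(3.11) p.656 (bookkeeping)] -/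
theorem W_crOfRecord₁₃VAt_le_one (K : ℕ) : (crOfRecord₁₃VAt K₀ jcut sh F θ hP g₀ os).W K ≤ 1 :=
  wInf_le_of_mem (one_mem_admW_carriers₁₃ θ hP K₀ g₀ os jcut K)

/-- **… AND LIES IN `[0, 1]`** (dag-n20-d's `wInf_nonneg`). [cite: Balaban1989LargeFieldII, (1.80) p.384; King1986, (3.10)–(3.11) p.656 (bookkeeping)] -/
theorem W_crOfRecord₁₃VAt_mem_Icc (K : ℕ) : (crOfRecord₁₃VAt K₀ jcut sh F θ hP g₀ os).W K ∈ Set.Icc (0 : ℝ) 1 :=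
  ⟨wInf_nonneg K, W_crOfRecord₁₃VAt_le_one θ hP K₀ g₀ os jcut sh K⟩

/-- **THE READING's `W` IS A RELATIVE WEIGHT OF ITS PERSISTENCE CLASS, run A** — hypothesis-free at a tuple with core provisos: for every step `K` and source `|t| ≤ 1`,
`Σ_{x ∈ Bad K t} A K t x ≤ W K · Σ_{x ∈ T K} A K t x` at `crOfRecord₁₃VAt K₀ jcut sh …`. [cite: Balaban1989LargeFieldII, (1.80) p.384; King1986, (3.10)–(3.11) p.656 (bookkeeping)] -/
theorem badMass_le_W_crOfRecord₁₃VAt_left (K : ℕ) {t : ℝ} (ht : |t| ≤ 1) :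
    ∑ x ∈ (crOfRecord₁₃VAt K₀ jcut sh F θ hP g₀ os).Bad K t, (crOfRecord₁₃VAt K₀ jcut sh F θ hP g₀ os).A K t x ≤
      (crOfRecord₁₃VAt K₀ jcut sh F θ hP g₀ os).W K * ∑ x ∈ (crOfRecord₁₃VAt K₀ jcut sh F θ hP g₀ os).T K, (crOfRecord₁₃VAt K₀ jcut sh F θ hP g₀ os).A K t x :=
  bad_left_wInf (fun K t _ x _ => weightA₁₃_nonneg F θ hP K₀ g₀ os K t x) (fun K t _ x _ => weightB₁₃_nonneg F θ hP K₀ g₀ os K t x)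
    (fun K t _ => badClass₁₃_subset θ K₀ g₀ jcut K t) K ht

/-- **… run B.** [cite: Balaban1989LargeFieldII, (1.80) p.384; King1986, (3.10)–(3.11) p.656 (bookkeeping)] -/
theorem badMass_le_W_crOfRecord₁₃VAt_right (K : ℕ) {t : ℝ} (ht : |t| ≤ 1) :
    ∑ x ∈ (crOfRecord₁₃VAt K₀ jcut sh F θ hP g₀ os).Bad K t, (crOfRecord₁₃VAt K₀ jcut sh F θ hP g₀ os).B K t x ≤
      (crOfRecord₁₃VAt K₀ jcut sh F θ hP g₀ os).W K * ∑ x ∈ (crOfRecord₁₃VAt K₀ jcut sh F θ hP g₀ os).T K, (crOfRecord₁₃VAt K₀ jcut sh F θ hP g₀ os).B K t x :=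
  bad_right_wInf (fun K t _ x _ => weightA₁₃_nonneg F θ hP K₀ g₀ os K t x) (fun K t _ x _ => weightB₁₃_nonneg F θ hP K₀ g₀ os K t x)
    (fun K t _ => badClass₁₃_subset θ K₀ g₀ jcut K t) K ht

/-- **★★ THE N20 FACE AT THE SPINE READING OF RECORD (PHYSICAL VOLUME) IS TWO NUMERIC CONDITIONS ON ITS OWN `W`** — at EVERY Stage-13 tuple with core provisos, every `K₀`, `jcut`,
`sh`, `g₀`, `os`, HYPOTHESIS-FREE: `RelWeightBound (cr…).l₀ (cr…).T (cr…).A (cr…).B (cr…).Bad (cr…).W ⟺ (∀ K, (cr…).W K < 1) ∧ Summable (cr…).W` for `cr… := crOfRecord₁₃VAt K₀ jcut sh F θ hP g₀ os`.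
So NE7b AT THE RECORD under the policy `jcut` reads: «the persistent-activity fractions of record decay summably and never reach `1`».
[cite: Balaban1989LargeFieldII, Thm 1 + (0.1) pp.355–356, (1.80) p.384; King1986, (3.10)–(3.11) p.656 (bookkeeping)] -/
theorem relWeightBound_crOfRecord₁₃VAt_iff :
    RelWeightBound (crOfRecord₁₃VAt K₀ jcut sh F θ hP g₀ os).l₀ (crOfRecord₁₃VAt K₀ jcut sh F θ hP g₀ os).T (crOfRecord₁₃VAt K₀ jcut sh F θ hP g₀ os).A
        (crOfRecord₁₃VAt K₀ jcut sh F θ hP g₀ os).B (crOfRecord₁₃VAt K₀ jcut sh F θ hP g₀ os).Bad (crOfRecord₁₃VAt K₀ jcut sh F θ hP g₀ os).W ↔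
      (∀ K, (crOfRecord₁₃VAt K₀ jcut sh F θ hP g₀ os).W K < 1) ∧ Summable (crOfRecord₁₃VAt K₀ jcut sh F θ hP g₀ os).W :=
  relWeightBound_wInf_iff_lt_one_summable (fun K t _ x _ => weightA₁₃_nonneg F θ hP K₀ g₀ os K t x) (fun K t _ x _ => weightB₁₃_nonneg F θ hP K₀ g₀ os K t x)
    fun K t _ => badClass₁₃_subset θ K₀ g₀ jcut K t

/-- **THE v1.0 TWIN** (`crOfRecord₁₃At`; the N20 face does not read `vol`). [cite: Balaban1989LargeFieldII, Thm 1 + (0.1) pp.355–356, (1.80) p.384; King1986, (3.10)–(3.11) p.656 (bookkeeping)] -/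
theorem relWeightBound_crOfRecord₁₃At_iff :
    RelWeightBound (crOfRecord₁₃At K₀ jcut sh F θ hP g₀ os).l₀ (crOfRecord₁₃At K₀ jcut sh F θ hP g₀ os).T (crOfRecord₁₃At K₀ jcut sh F θ hP g₀ os).A
        (crOfRecord₁₃At K₀ jcut sh F θ hP g₀ os).B (crOfRecord₁₃At K₀ jcut sh F θ hP g₀ os).Bad (crOfRecord₁₃At K₀ jcut sh F θ hP g₀ os).W ↔
      (∀ K, (crOfRecord₁₃At K₀ jcut sh F θ hP g₀ os).W K < 1) ∧ Summable (crOfRecord₁₃At K₀ jcut sh F θ hP g₀ os).W :=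
  relWeightBound_wInf_iff_lt_one_summable (fun K t _ x _ => weightA₁₃_nonneg F θ hP K₀ g₀ os K t x) (fun K t _ x _ => weightB₁₃_nonneg F θ hP K₀ g₀ os K t x)
    fun K t _ => badClass₁₃_subset θ K₀ g₀ jcut K t

/-- **SOME WITNESS AT THE CARRIERS OF RECORD ⟺ THE SAME TWO CONDITIONS ON THE READING's `W`** (dag-n20-d's `relWeightBound_crOfRecord₁₃VAt` transfers any witness; this is the
converse bookkeeping: nothing is lost by reading N20 through the canonical weight). [cite: Balaban1989LargeFieldII, (1.80) p.384; King1986, (3.10)–(3.11) p.656 (bookkeeping)] -/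
theorem exists_relWeightBound_carriers₁₃_iff :
    (∃ W : ℕ → ℝ, RelWeightBound 1 (classSet₁₃ θ K₀ g₀) (weightA₁₃ θ hP K₀ g₀ os) (weightB₁₃ θ hP K₀ g₀ os) (badClass₁₃ θ K₀ g₀ jcut) W) ↔
      (∀ K, (crOfRecord₁₃VAt K₀ jcut sh F θ hP g₀ os).W K < 1) ∧ Summable (crOfRecord₁₃VAt K₀ jcut sh F θ hP g₀ os).W :=
  exists_relWeightBound_iff_lt_one_summable (fun K t _ x _ => weightA₁₃_nonneg F θ hP K₀ g₀ os K t x) (fun K t _ x _ => weightB₁₃_nonneg F θ hP K₀ g₀ os K t x)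
    fun K t _ => badClass₁₃_subset θ K₀ g₀ jcut K t

end Reading

/-! ## §3  The two ends of the dial in the fraction: `W K = 1` above the window on a live tuple (`W ≡ 0` at the zero cut is dag-n20-w1's `crOfRecord₁₃VAt_W_cutZero`) -/

section Ends

variable {F : T4Family} {N : ℕ} [NeZero N] (θ : Stage13HParams F N) (hP : θ.Provisos₁₃CoPH F N) (K₀ : ℕ) (g₀ : ℕ → ℝ) (os : List (ULoop F))
  (E : B12.RunParams → ℝ)

/-- **★ ABOVE THE WINDOW THE PERSISTENT-ACTIVITY FRACTION OF RECORD IS EXACTLY `1`** (live-selector pin, (H-U) ∕ (H-ζ); `0 ≤ ζ` from `hP`): `K₀ + K < jcut K ⇒ (crOfRecord₁₃VAt K₀ jcut sh …).W K = 1`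
— CLAIM-1's `badClass₁₃ = classSet₁₃` at that step, E1 at `t = 0` and the positivity of the dressed partition function of record.  With `W K < 1` (§2) this re-derives CLAIM-1's window.
[cite: Balaban1988Convergent, (2.18) p.257; Balaban1989LargeFieldII, (1.80) p.384; King1986, (3.10)–(3.11) p.656 (bookkeeping)] -/
theorem W_crOfRecord₁₃VAt_eq_one_of_overCut (sh : ShellSplit₁₃CoPH N K₀) (hsel : θ.ppSel = ppSelLiveOfRecord F N θ.ν θ.τ9 E (wOfRecord₉ F N θ.toStage9Params))
    (hU : LocalBgMeasurable F N θ.ν) (hζm : ZetaMeasurable F N θ.ζ) {jcut : ℕ → ℕ} {K : ℕ} (hK : K₀ + K < jcut K) :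
    (crOfRecord₁₃VAt K₀ jcut sh F θ hP g₀ os).W K = 1 := by
  have hpos := schemeZ_pos_datumOfRecord₁₃CoPH θ hP g₀ os (K₀ + K) 0
  rw [schemeZ_eq_sum_classSet_weightA K₀ θ hP E hsel hU hζm (zeta_nonneg_of_provisos₁₃CoPH F θ hP) g₀ os K 0] at hpos
  exact wInf_eq_one_of_bad_eq (fun K t _ x _ => weightA₁₃_nonneg F θ hP K₀ g₀ os K t x) (fun K t _ x _ => weightB₁₃_nonneg F θ hP K₀ g₀ os K t x)
    (fun K t _ => badClass₁₃_subset θ K₀ g₀ jcut K t) (t₀ := 0) (by rw [abs_zero]; exact zero_le_one) (badClass₁₃_eq_classSet₁₃_of_overCut θ K₀ g₀ jcut K 0 hK) hpos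

/-- **THE v1.0 TWIN.** [cite: Balaban1988Convergent, (2.18) p.257; Balaban1989LargeFieldII, (1.80) p.384; King1986, (3.10)–(3.11) p.656 (bookkeeping)] -/
theorem W_crOfRecord₁₃At_eq_one_of_overCut (sh : ShellSplit₁₃CoPH N K₀) (hsel : θ.ppSel = ppSelLiveOfRecord F N θ.ν θ.τ9 E (wOfRecord₉ F N θ.toStage9Params))
    (hU : LocalBgMeasurable F N θ.ν) (hζm : ZetaMeasurable F N θ.ζ) {jcut : ℕ → ℕ} {K : ℕ} (hK : K₀ + K < jcut K) :
    (crOfRecord₁₃At K₀ jcut sh F θ hP g₀ os).W K = 1 :=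
  W_crOfRecord₁₃VAt_eq_one_of_overCut θ hP K₀ g₀ os E sh hsel hU hζm hK

end Ends

/-! ## §4  The K3⁷ v3 binder shape (`N = 2`): `KeyedRelWeight` at the per-tuple-cut V reading ⟺ the keyed family of the two numeric conditions -/

section Shapes

/-- **★★ THE K3⁷ v3 `KeyedRelWeight` BODY AT THE PER-TUPLE-CUT V READING OF RECORD `fun F θ hP g₀ os ↦ crOfRecord₁₃VAt 0 (jc F θ hP g₀ os) sh F θ hP g₀ os`, SPELLED OUT, IS EQUIVALENT
TO**: at every guarded admissible Stage-13 tuple with core provisos, every `g₀`, `os`, the persistent-activity fractions of record under the cut reading `jc` are `< 1` at every step and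
summable (the guards are not used; the skeleton's `def` is not the tree's). [cite: Balaban1989LargeFieldII, Thm 1 + (0.1) pp.355–356, (1.80) p.384; King1986, (3.10)–(3.11) p.656 (bookkeeping)] -/
theorem keyedRelWeight_shape_crOfRecord₁₃VAt_iff
    (jc : (F : T4Family) → (θ : Stage13HParams F 2) → θ.Provisos₁₃CoPH F 2 → (ℕ → ℝ) → List (ULoop F) → ℕ → ℕ) (sh : ShellSplit₁₃CoPH 2 0) :
    (∀ (F : T4Family) (θ : Stage13HParams F 2) (hP : θ.Provisos₁₃CoPH F 2), (θ.ZhUnity F 2 ∧ θ.SlotsNondegenerate₁₃ F 2) → θ.Admissible F 2 →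
      ∀ (g₀ : ℕ → ℝ) (os : List (ULoop F)),
        RelWeightBound (crOfRecord₁₃VAt 0 (jc F θ hP g₀ os) sh F θ hP g₀ os).l₀ (crOfRecord₁₃VAt 0 (jc F θ hP g₀ os) sh F θ hP g₀ os).T
          (crOfRecord₁₃VAt 0 (jc F θ hP g₀ os) sh F θ hP g₀ os).A (crOfRecord₁₃VAt 0 (jc F θ hP g₀ os) sh F θ hP g₀ os).B
          (crOfRecord₁₃VAt 0 (jc F θ hP g₀ os) sh F θ hP g₀ os).Bad (crOfRecord₁₃VAt 0 (jc F θ hP g₀ os) sh F θ hP g₀ os).W) ↔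
    (∀ (F : T4Family) (θ : Stage13HParams F 2) (hP : θ.Provisos₁₃CoPH F 2), (θ.ZhUnity F 2 ∧ θ.SlotsNondegenerate₁₃ F 2) → θ.Admissible F 2 →
      ∀ (g₀ : ℕ → ℝ) (os : List (ULoop F)),
        (∀ K, (crOfRecord₁₃VAt 0 (jc F θ hP g₀ os) sh F θ hP g₀ os).W K < 1) ∧ Summable (crOfRecord₁₃VAt 0 (jc F θ hP g₀ os) sh F θ hP g₀ os).W) :=
  forall₅_congr fun F θ hP _ _ => forall₂_congr fun g₀ os => relWeightBound_crOfRecord₁₃VAt_iff θ hP 0 g₀ os (jc F θ hP g₀ os) sh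

end Shapes

end Summit.QuantumFields.YangMills.BalabanUVNodes.N20KeyedRelWeightCanonical

end
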